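import Literature.Barriers.Parity.FordMaynardPrimeSieves
import Literature.NumberTheory.Sieve.FordMaynardFramework
import HarnessLib

/-!
# Ford–Maynard, Theorem 2.1 (minimal Type-II range): decomposition of `FordMaynardMinimalTypeII`

Companion of `FordMaynardPrimeSieves.lean` for its Entry 1, the named fact
`Literature.Barriers.Parity.FordMaynardMinimalTypeII` (K. Ford, J. Maynard, *On the theory of
prime producing sieves*, arXiv:2407.14368, Theorem 2.1). The printed proof (§9, "we prove
Theorem 2.1 … using Theorem 6.3 (a), and then tweak the function", p. 50) has two halves, which
are vendored here as named facts over the statement layer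
`Literature/NumberTheory/Sieve/FordMaynardFramework.lean` (the class `𝔉*_η(γ)` =
`FordMaynard.MemTypeIStar`):

* `FordMaynardPrimeFreeOfTypeIStar` — **Theorem 9.1**: for `1/2 ≤ γ < 1`, a function
  `f ∈ 𝔉*_η(γ)` with `f(1) < −1` on the prime vector and `f ≥ −1` on all vectors of dimension
  `≥ 2` yields `ν₀ = ν₀(γ) > 0` such that prime-free admissible sequences exist for every
  `(γ, θ, ν) ∈ 𝒬₀` with `ν ≤ ν₀` and every `B > 0` (its proof is the general construction
  Theorem 6.3 (a) — fragmentation identity Theorem 6.4, prime sums to integrals Lemma 5.11 — plus a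
  measure argument in `ν`);
* `FordMaynardTypeIStarBelowMinusOne` — **§9.2** (with Lemmas 9.2–9.5, the modified Liouville
  functions `λ̃^{(c,η)}` and the Dickman-function bounds of Lemma 9.3): for `1/2 < γ < 1` such an
  `f` exists, with `0 < η < 1 − γ`;

and the target is PROVED from them:

* `FordMaynard.TypeI.mono_level`, `FordMaynard.PrimeFreeAdmissible.mono_level` — (I) at level
  `x^{γ'}` implies (I) at every level `x^γ`, `γ ≤ γ'` (the summands are non-negative), so
  prime-free admissibility descends in `γ`;
* `FordMaynardMinimalTypeII_of_typeIStar` — Theorem 2.1 for all `0 < γ < 1` from the two facts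
  (for `γ ≤ 1/2` through `γ' = max(γ, 3/4)`, as (I) is monotone in the level; the source treats
  `1/2 < γ < 1` in §9.2 and notes the monotonicity in Proposition 4.10).

Discharging the two facts (making `FordMaynardMinimalTypeII` a theorem) is the remaining work;
nothing in this file uses unpublished statements.

## References

* K. Ford, J. Maynard, *On the theory of prime producing sieves*, arXiv:2407.14368v1 (2024):
  Theorem 2.1 (p. 5); Proposition 4.10 (monotonicity); §6 Theorem 6.3; §9 Theorem 9.1 and its
  proof (chunk 50), §9.1 Lemmas 9.2–9.5, §9.2 "The proof of Theorem 9.1's hypothesis"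
  (chunks 50–53). (`lit read arxiv:2407.14368`.) [FordMaynard2024PrimeSieves]
-/

noncomputable section

open Finset

namespace Literature.Barriers.Parity

open Literature.NumberTheory.Sieve

namespace FordMaynard

/-! ### Monotonicity of (I) in the level -/

/-- The Type-I bound (I) is monotone in the level: (I) at level `x^{γ'}` implies (I) at level
`x^γ` for `γ ≤ γ'` and `x ≥ 1` (the sum over `m ≤ x^γ` is a sub-sum of non-negative terms).
[cite: FordMaynard2024PrimeSieves, Proposition 4.10] -/
theorem TypeI.mono_level {w : ℕ → ℝ} {x γ γ' B : ℝ} (hx : 1 ≤ x) (hγ : γ ≤ γ')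
    (h : TypeI w x γ' B) : TypeI w x γ B := by
  intro I
  refine le_trans ?_ (h I)
  apply Finset.sum_le_sum_of_subset_of_nonneg
  · exact Finset.Icc_subset_Icc_right
      (Nat.floor_le_floor (Real.rpow_le_rpow_of_exponent_le hx hγ))
  · intro m _ _
    exact mul_nonneg (Real.rpow_nonneg (Nat.cast_nonneg _) _) (abs_nonneg _)

/-- Prime-free admissibility descends in the Type-I level: `γ ≤ γ'` and
`PrimeFreeAdmissible γ' θ ν B` give `PrimeFreeAdmissible γ θ ν B` (same sequences, from
`x ≥ max(x₀, 1)` on). [cite: FordMaynard2024PrimeSieves, Proposition 4.10] -/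
theorem PrimeFreeAdmissible.mono_level {γ γ' θ ν B : ℝ} (hγ : γ ≤ γ')
    (h : PrimeFreeAdmissible γ' θ ν B) : PrimeFreeAdmissible γ θ ν B := by
  obtain ⟨C, x₀, hx₀⟩ := h
  refine ⟨C, max x₀ 1, fun x hx => ?_⟩
  obtain ⟨a, ha, hI, hII, hp⟩ := hx₀ x (le_trans (le_max_left _ _) hx)
  exact ⟨a, ha, hI.mono_level (le_trans (le_max_right _ _) hx) hγ, hII, hp⟩

end FordMaynard

/-! ### The two halves of the printed proof of Theorem 2.1, as named facts -/

/-- **Ford–Maynard, Theorem 9.1** (arXiv:2407.14368, §9). Fix `γ ∈ [1/2, 1)`. Suppose there are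
`η > 0` and a function `f ∈ 𝔉*_η(γ)` (`FordMaynard.MemTypeIStar η γ f`: symmetric, bounded,
supported on vectors with components `≥ η` summing to `1`, piecewise Lipschitz on convex
polytopes, satisfying the Type-I identity (TypeI-f)) such that `f(1) < −1` (the value on the
one-dimensional vector `(1)`, "contribution to primes") and `f(β) ≥ −1` for all
`β = (β₁, …, β_k)` with `k ≥ 2`. Then Theorem 2.1 holds for this `γ`: there is `ν₀ > 0`,
depending only on `γ`, such that whenever `P = (γ, θ, ν) ∈ 𝒬₀` (`0 ≤ θ < 1/2`,
`0 < ν ≤ 1 − θ`), `ν ≤ ν₀` and `B > 0`, for all large `x` there is a bounded non-negative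
sequence `(a_n)` with `w_n = a_n − 1` satisfying (I) and (II) and `a_p = 0` for all primes
`p ∈ (x/2, x]` (transcribed as `FordMaynard.PrimeFreeAdmissible γ θ ν B`, the shape of
Theorem 2.1; boundedness is part of Theorem 2.1 and of Theorem 6.3 (a), through which the
printed proof goes). The extra hypothesis `η < 1 − γ` is the standing assumption of Theorem 6.3
used in that proof; with it the fact is weaker than the printed statement.
[cite: FordMaynard2024PrimeSieves, Theorem 9.1] [cite: FordMaynard2024PrimeSieves, Theorem 6.3 (a)] -/
def FordMaynardPrimeFreeOfTypeIStar : Prop :=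
  ∀ γ : ℝ, 1 / 2 ≤ γ → γ < 1 →
    (∃ η : ℝ, 0 < η ∧ η < 1 - γ ∧ ∃ f : FordMaynard.VecFn,
        FordMaynard.MemTypeIStar η γ f ∧ f 1 (fun _ => 1) < -1 ∧
          ∀ k : ℕ, 2 ≤ k → ∀ β : Fin k → ℝ, -1 ≤ f k β) →
      ∃ ν₀ : ℝ, 0 < ν₀ ∧
        ∀ θ ν B : ℝ, 0 ≤ θ → θ < 1 / 2 → 0 < ν → ν ≤ 1 - θ → ν ≤ ν₀ → 0 < B →
          FordMaynard.PrimeFreeAdmissible γ θ ν B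

/-- **Ford–Maynard, §9.2** (arXiv:2407.14368, "The proof of Theorem 2.1" via Theorem 9.1). For
every `γ` with `1/2 < γ < 1` there are `η` with `0 < η < 1 − γ` and a function `f ∈ 𝔉*_η(γ)`
with `f(1) < −1` and `f(β) ≥ −1` for all vectors `β` of dimension `≥ 2`. (Printed construction:
`c = (1 − γ)/2`, `0 < η < ε < c`, `f = λ̃^{(1−γ,η)} + g/g₀` with `g = (1 − 2^{k−3}) λ̃^{(c,ε)}`,
`g₀ = 2^{1/ε}`, where `λ̃^{(c,η)}(ξ) = ∏ M^{(c,η)}(ξ_i)` are the modified Liouville functions of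
§9.1; `f ∈ 𝔉*_η(γ)` by Lemma 9.5 (from the identity Lemma 9.2), `f(1) ≤ −1 − 1/(4g₀)` and
`f ≥ −1` in dimension `≥ 2` by the Dickman-function bounds of Lemma 9.3.)
[cite: FordMaynard2024PrimeSieves, §9.2] [cite: FordMaynard2024PrimeSieves, Lemma 9.5] [cite: FordMaynard2024PrimeSieves, Lemma 9.3] -/
def FordMaynardTypeIStarBelowMinusOne : Prop :=
  ∀ γ : ℝ, 1 / 2 < γ → γ < 1 →
    ∃ η : ℝ, 0 < η ∧ η < 1 - γ ∧ ∃ f : FordMaynard.VecFn,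
      FordMaynard.MemTypeIStar η γ f ∧ f 1 (fun _ => 1) < -1 ∧
        ∀ k : ℕ, 2 ≤ k → ∀ β : Fin k → ℝ, -1 ≤ f k β

/-! ### Theorem 2.1 from the two facts -/

/-- **Theorem 2.1 from Theorem 9.1 and §9.2.** The named fact `FordMaynardMinimalTypeII`
(minimal Type-II range: for every `0 < γ < 1` some `ν₀(γ) > 0` makes every
`(γ, θ, ν) ∈ 𝒬₀`, `ν ≤ ν₀`, `B > 0` prime-free admissible) follows from
`FordMaynardPrimeFreeOfTypeIStar` (Theorem 9.1) and `FordMaynardTypeIStarBelowMinusOne` (§9.2):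
for `γ ≤ 1/2` one uses `γ' = max(γ, 3/4)` and the monotonicity of (I) in the level
(`FordMaynard.PrimeFreeAdmissible.mono_level`). [cite: FordMaynard2024PrimeSieves, Theorem 2.1 (proof, §9)] -/
theorem FordMaynardMinimalTypeII_of_typeIStar (hA : FordMaynardPrimeFreeOfTypeIStar)
    (hB : FordMaynardTypeIStarBelowMinusOne) : FordMaynardMinimalTypeII := by
  intro γ hγ0 hγ1
  set γ' : ℝ := max γ (3 / 4) with hγ'
  have hγ'0 : 1 / 2 < γ' := lt_of_lt_of_le (by norm_num) (le_max_right _ _)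
  have hγ'1 : γ' < 1 := max_lt hγ1 (by norm_num)
  obtain ⟨η, hη0, hη1, f, hf, hf1, hf2⟩ := hB γ' hγ'0 hγ'1
  obtain ⟨ν₀, hν₀, H⟩ := hA γ' hγ'0.le hγ'1 ⟨η, hη0, hη1, f, hf, hf1, hf2⟩
  refine ⟨ν₀, hν₀, fun θ ν B hθ0 hθ1 hν0 hν1 hνν₀ hB0 => ?_⟩
  exact (H θ ν B hθ0 hθ1 hν0 hν1 hνν₀ hB0).mono_level (le_max_left _ _)

end Literature.Barriers.Parity
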